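import Summits.ResolutionOfSingularities.ResolutionOfSingularities.Theorems.HilbertSamuelEliminationSigmaMaxModificationsCorridor3WLadderMovingTwoLocDefs
import Literature.AlgebraicGeometry.CossartJannsenSaito2020.KeyTheoremsLocalLinks
import Literature.AlgebraicGeometry.CossartJannsenSaito2020.BlowupTowerLocalizeTransfer
import Summits.ResolutionOfSingularities.ResolutionOfSingularities.Theorems.HilbertSamuelEliminationSigmaMaxModificationsCorridor3WLadderForcedGameTowers
import Literature.AlgebraicGeometry.Resolution.ExcellentBlowup
import Literature.AlgebraicGeometry.Resolution.BlowupReducedDimension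
import HarnessLib

/-!
# [OURS · L1 W4.2] Row β (`stub_twoClaims` → `stub_keyClaim : Moving.KeyTheorem640_localized_isolated`), port layer 0:
# the key setting along a unit-wise LOCALISED chain of fundamental units, tails of chains, and the reduction of
# «no infinite chain» to a per-unit non-increasing ℕ-invariant plus «no infinite chain with constant invariant»

Stub worker res-L1-w42-stub-3 (gen 7), crux chain w42 (`SigmaMaxModifications`, stmt-…-18506; conjunct `…Corridor3`,
stmt-…-19249), line `w_ladder_rows` v8.6. HELPER file (`--supports stmt-…-19249`): closes no item, asserts nothing of
[Hironaka2017] nor of [CossartJannsenSaito2020], introduces no definition.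

The β-row residue of record (census₇, `…Corridor3WLadderMovingTwoCensus7`) is ONE OURS claim,
`Moving.KeyTheorem640_localized_isolated` = CJS Key Theorem 6.40 for unit-wise localised chains with isolated initial points,
characteristic-free (`…MovingTwoLocDefs`). Its only honest discharge is a port of the printed proof (LNM 2270 Chs. 7–14 with
Thm. 3.14 replaced by the (F1♯) doors; memo `HOME/L/res-L1-w42-stub-3/BETA-UNITS-SCOPE.md`). The printed proof (Ch. 13, Step 2,
Thm. 13.7; Ch. 14, Thm. 14.4) is an induction ALONG THE UNITS of the chain: every unit's initial part `(x^{(q)}, X^{(q)})` must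
again be in the standing setting (excellent, `dim ≤ N`, local at a closed point), the invariant
`β_q = β^O_{x^{(q)}}(X^{(q)}, Z^{(q)}) ∈ (1/n_N!)ℤ_{≥0}` never increases along a unit (Prop. 13.5 / Thm. 14.4), «Hence we may assume
`β_q = β_0` for all `q ≥ 0`» (p. 157 — i.e. one passes to a TAIL of the chain), and an infinite chain with constant `β` is then
excluded (Claim 13.8, `ζ^O`). This file supplies, sorry-free and characteristic-free, the bookkeeping that this induction
consumes on the typed carrier `IsLocalizedChainOfFundamentalUnits` (`KeyTheoremsLocal.lean`):

* `topologicalKrullDim_X_le`, `keySetting_drop` — the key setting propagates to every stage / truncation of ONE tower (blow-ups of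
  excellent schemes are excellent — tree `IdeasL1C4.isExcellent_stage`; blow-ups do not raise the dimension,
  `IsBlowup.topologicalKrullDim_le_of_isLocallyNoetherian`);
* `isExcellent_of_isLocalSchemeAt`, `topologicalKrullDim_le_of_isLocalSchemeAt`, `hsFun_eq_of_isLocalSchemeAt` — the local
  scheme `(Y, y) ≅ (Spec 𝒪_{X,x}, 𝔪)` of an excellent `X` is excellent, `dim Y ≤ dim X`, `H_Y(y) = H_X(x)`;
* `keySetting_all` — **every unit of a localised chain in the key setting is in the key setting**;
  `tail` — the chain from unit `k` on is a localised chain; `hsFun_pt` — `H` is the same at all initial points;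
  `isClosed_pt`, `dirDimAt_pt`, `geomDirDimAt_pt` — every initial point is closed with `e = ē = 2`;
* `keyTheorem640_localized_isolated_of_exists_lt` — **reduction 1**: the claim follows once SOME `ℕ`-valued function of pointed
  schemes strictly drops somewhere along every localised chain in the key setting with isolated starts;
* `keyTheorem640_localized_isolated_of_antitone_of_const` — **reduction 2 (the printed architecture)**: the claim follows from
  (i) an `ℕ`-valued function `β` of pointed schemes with `β(x^{(q+1)}) ≤ β(x^{(q)})` along every such chain (Prop. 13.5 ∧ Thm. 14.4,
  numerators over `n_N!`) and (ii) «no such infinite chain has constant `β`» (Thm. 13.7's Claim 13.8 with Thm. 14.4).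

Nothing here is specific to `p = 2` or `dim X = 3`. OURS (cell res-hironaka, slot W4.2); NOT statements of the manuscript
[Hironaka2017] nor of [CossartJannsenSaito2020]; AI-written, weaker than expert review.
References: CJS LNM 2270 Def. 6.38/6.39, Thm. 6.40, p. 107, Prop. 13.5, Thm. 13.7, Claim 13.8, Thm. 14.4 [CossartJannsenSaito2020];
Matsumura, *Commutative Ring Theory*, §32 [Matsumura1987].
-/

noncomputable section

-- `Summit.<Summit>.<Problem>` with Summit = Problem = `ResolutionOfSingularities` (single-conjunct layout, D-0017) trips this linter
set_option linter.dupNamespace false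

open CategoryTheory AlgebraicGeometry TopologicalSpace IsLocalRing
open Literature.AlgebraicGeometry.Resolution Literature.AlgebraicGeometry.CossartJannsenSaito2020
open Summit.ResolutionOfSingularities.ResolutionOfSingularities.Cruxes.SigmaMaxModifications.IdeasL1C4 (isExcellent_stage)

namespace Summit.ResolutionOfSingularities.ResolutionOfSingularities.Theorems.SigmaMaxModificationsCorridor3.KeyClaim

universe u

/-! ## One tower: the key setting propagates to every stage and every truncation -/

/-- Blow-ups do not raise the dimension: `dim X_0 ≤ N ⇒ dim X_n ≤ N` for every stage of a tower.
[cite: CossartJannsenSaito2020, Thm. 3.10 (proof)] -/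
theorem topologicalKrullDim_X_le (T : BlowupTower.{u}) {N : ℕ}
    (h0 : topologicalKrullDim ↥(T.X 0) ≤ (N : WithBot ℕ∞)) : ∀ n, topologicalKrullDim ↥(T.X n) ≤ (N : WithBot ℕ∞)
  | 0 => h0
  | n + 1 => by
    haveI : IsLocallyNoetherian (T.X n) := T.ln n
    exact (T.isBlowup n).topologicalKrullDim_le_of_isLocallyNoetherian (topologicalKrullDim_X_le T h0 n)

/-- The key setting (excellent, `dim ≤ N`) passes from a tower to each of its truncations `X_a ← X_{a+1} ← ⋯`.
[cite: CossartJannsenSaito2020, Thm. 6.28 (setting), p. 107] -/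
theorem keySetting_drop {T : BlowupTower.{u}} {N : ℕ} (h : KeySetting T N) (a : ℕ) : KeySetting (T.drop a) N :=
  ⟨isExcellent_stage T h.excellent a, topologicalKrullDim_X_le T h.dim_le a⟩

/-! ## Local schemes of a point of an excellent scheme -/

/-- The local scheme `(Y, y) ≅ (Spec 𝒪_{X,x}, 𝔪_x)` of a point of an excellent locally noetherian scheme is excellent
(the local rings of an excellent scheme are excellent, Matsumura §32; `Spec` of an excellent ring is excellent; transport
along the isomorphism). [cite: Matsumura1987, §32 p. 260] -/
theorem isExcellent_of_isLocalSchemeAt {Y X : Scheme.{u}} {y : Y} {x : X} [IsLocallyNoetherian X]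
    (h : IsLocalSchemeAt Y y X x) (hX : Scheme.IsExcellent X) : Scheme.IsExcellent Y := by
  obtain ⟨e, -⟩ := h
  have hS : Scheme.IsExcellent (Spec (X.presheaf.stalk x)) :=
    Scheme.isExcellent_Spec_of_isExcellentRing _ (isExcellentRing_stalk_of_isExcellent hX x)
  exact Scheme.IsExcellent.of_isOpenImmersion e.hom hS

/-- `dim Y ≤ dim X` for the local scheme `(Y, y)` of `X` at `x` (`Spec 𝒪_{X,x} → X` is a topological embedding).
[cite: CossartJannsenSaito2020, p. 107] -/
theorem topologicalKrullDim_le_of_isLocalSchemeAt {Y X : Scheme.{u}} {y : Y} {x : X}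
    (h : IsLocalSchemeAt Y y X x) {N : WithBot ℕ∞} (hX : topologicalKrullDim ↥X ≤ N) :
    topologicalKrullDim ↥Y ≤ N := by
  obtain ⟨e, -⟩ := h
  calc topologicalKrullDim ↥Y ≤ topologicalKrullDim ↥(Spec (X.presheaf.stalk x)) :=
        e.hom.isEmbedding.isInducing.topologicalKrullDim_le
    _ ≤ topologicalKrullDim ↥X := (X.fromSpecStalk x).isEmbedding.isInducing.topologicalKrullDim_le
    _ ≤ N := hX

/-- `H_Y(y) = H_X(x)` for the local scheme `(Y, y)` of `X` at `x` (the Hilbert–Samuel function depends only on the local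
ring). [cite: CossartJannsenSaito2020, Def. 2.28, p. 107] -/
theorem hsFun_eq_of_isLocalSchemeAt {Y X : Scheme.{u}} {y : Y} {x : X} [IsLocallyNoetherian X] [IsLocallyNoetherian Y]
    (h : IsLocalSchemeAt Y y X x) (N : ℕ) : Scheme.hsFun Y N y = Scheme.hsFun X N x := by
  obtain ⟨e, he⟩ := h
  rw [Scheme.hsFun_eq_of_isOpenImmersion e.hom N y, he, Scheme.hsFun_fromSpecStalk_closedPoint]

/-- `e_y(Y) = e_x(X)` for the local scheme `(Y, y)` of `X` at `x`. [cite: CossartJannsenSaito2020, Def. 2.26, p. 107] -/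
theorem dirDim_eq_of_isLocalSchemeAt {Y X : Scheme.{u}} {y : Y} {x : X} [IsLocallyNoetherian X] [IsLocallyNoetherian Y]
    (h : IsLocalSchemeAt Y y X x) : Scheme.dirDim Y y = Scheme.dirDim X x := by
  obtain ⟨e, he⟩ := h
  rw [Scheme.dirDim_eq_of_isOpenImmersion e.hom y, he, Scheme.dirDim_fromSpecStalk_closedPoint]

/-! ## Along a unit-wise localised chain of fundamental units -/

section Chain

variable {T : ℕ → BlowupTower.{u}} {N : ℕ} {len : ℕ → ℕ} {pt : ∀ i, (T i).X 0} {tpt : ∀ i, (T i).X (len i)}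

/-- One step: if unit `i` of a localised chain starts in the key setting, so does unit `i + 1` (its initial stage is the
local scheme of the stage `X_{m_i}` of tower `i`, which is excellent of dimension `≤ N`).
[cite: CossartJannsenSaito2020, Def. 6.39, p. 107, Thm. 13.7 (proof)] -/
theorem keySetting_succ (hc : IsLocalizedChainOfFundamentalUnits T N len pt tpt) (i : ℕ) (h : KeySetting (T i) N) :
    KeySetting (T (i + 1)) N := by
  haveI : IsLocallyNoetherian ((T i).X (len i)) := (T i).ln (len i)
  exact ⟨isExcellent_of_isLocalSchemeAt (hc.link i) (isExcellent_stage (T i) h.excellent (len i)),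
    topologicalKrullDim_le_of_isLocalSchemeAt (hc.link i) (topologicalKrullDim_X_le (T i) h.dim_le (len i))⟩

/-- **Every unit of a localised chain in the key setting is in the key setting** (the standing setting of Chs. 12–14 at
every initial part `(x^{(q)}, X^{(q)})`). [cite: CossartJannsenSaito2020, Thm. 13.7 (proof), p. 107] -/
theorem keySetting_all (hc : IsLocalizedChainOfFundamentalUnits T N len pt tpt) (h0 : KeySetting (T 0) N) :
    ∀ i, KeySetting (T i) N
  | 0 => h0
  | i + 1 => keySetting_succ hc i (keySetting_all hc h0 i)

/-- **Tails**: the chain from unit `k` on is again a unit-wise localised chain («Hence we may assume `β_q = β_0` for all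
`q ≥ 0`», p. 157 — the printed proof passes to a tail). [cite: CossartJannsenSaito2020, Thm. 13.7 (proof), Def. 6.39] -/
theorem tail (hc : IsLocalizedChainOfFundamentalUnits T N len pt tpt) (k : ℕ) :
    IsLocalizedChainOfFundamentalUnits (fun i => T (k + i)) N (fun i => len (k + i)) (fun i => pt (k + i))
      (fun i => tpt (k + i)) where
  isLocalAt_zero := hc.isLocalAt k
  unit i := hc.unit (k + i)
  link i := hc.link (k + i)

/-- Every initial point of a localised chain is a closed point of its (local) initial stage.
[cite: CossartJannsenSaito2020, Def. 6.38 (i)] -/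
theorem isClosed_pt (hc : IsLocalizedChainOfFundamentalUnits T N len pt tpt) (i : ℕ) :
    IsClosed ({pt i} : Set ((T i).X 0)) :=
  (hc.unit i).isClosed_point

/-- `e = 2` at every initial point. [cite: CossartJannsenSaito2020, Def. 6.38 (i)] -/
theorem dirDimAt_pt (hc : IsLocalizedChainOfFundamentalUnits T N len pt tpt) (i : ℕ) : (T i).dirDimAt 0 (pt i) = 2 :=
  (hc.unit i).dirDim_eq

/-- `ē = 2` at every initial point. [cite: CossartJannsenSaito2020, Def. 6.38 (i)] -/
theorem geomDirDimAt_pt (hc : IsLocalizedChainOfFundamentalUnits T N len pt tpt) (i : ℕ) :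
    (T i).geomDirDimAt 0 (pt i) = 2 :=
  (hc.unit i).geomDirDim_eq

/-- One step of `H`-constancy: `H_{X^{(i+1)}}(x^{(i+1)}) = H_{X^{(i)}}(x^{(i)})` (the terminal point of unit `i` is near to
its initial point, Def. 6.38 (vi), and `X^{(i+1)}` is the local scheme of `X_{m_i}` at it).
[cite: CossartJannsenSaito2020, Def. 6.38 (vi), Def. 6.39, p. 107] -/
theorem hsFun_pt_succ (hc : IsLocalizedChainOfFundamentalUnits T N len pt tpt) (i : ℕ) :
    Scheme.hsFun ((T (i + 1)).X 0) N (pt (i + 1)) = Scheme.hsFun ((T i).X 0) N (pt i) := by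
  haveI : IsLocallyNoetherian ((T i).X (len i)) := (T i).ln (len i)
  haveI : IsLocallyNoetherian ((T (i + 1)).X 0) := (T (i + 1)).ln 0
  rw [hsFun_eq_of_isLocalSchemeAt (hc.link i) N]
  exact (hc.unit i).terminal_near

/-- **`H` is constant along the initial points of a localised chain**: `H_{X^{(i)}}(x^{(i)}) = H_{X^{(0)}}(x^{(0)})`
(so `ν*(J_q)` and the denominators `n_N!` of `β_q` do not change, Thm. 13.7 proof, p. 157).
[cite: CossartJannsenSaito2020, Thm. 13.7 (proof), Def. 6.38 (vi)] -/
theorem hsFun_pt (hc : IsLocalizedChainOfFundamentalUnits T N len pt tpt) :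
    ∀ i, Scheme.hsFun ((T i).X 0) N (pt i) = Scheme.hsFun ((T 0).X 0) N (pt 0)
  | 0 => rfl
  | i + 1 => (hsFun_pt_succ hc i).trans (hsFun_pt hc i)

end Chain

/-! ## Reductions of the claim to per-unit invariants (the printed architecture of Thm. 13.7 / 14.4) -/

/-- **Reduction 1.** `Moving.KeyTheorem640_localized_isolated` («no infinite unit-wise localised chain of fundamental units
in the key setting with all initial points isolated in the Hilbert–Samuel locus») follows once there is an `ℕ`-valued
function `μ` of pointed schemes that STRICTLY DROPS SOMEWHERE along every such chain: iterating on tails gives an infinite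
strictly decreasing sequence of natural numbers. (Shape of use: `μ` = a numerator of a polyhedral invariant.)
[cite: CossartJannsenSaito2020, Thm. 13.7 (proof)] -/
theorem false_of_chain_of_exists_lt (μ : ∀ X : Scheme.{u}, X → ℕ)
    (hμ : ∀ (T : ℕ → BlowupTower.{u}) (N : ℕ) (len : ℕ → ℕ) (pt : ∀ i, (T i).X 0) (tpt : ∀ i, (T i).X (len i)),
      KeySetting (T 0) N → IsLocalizedChainOfFundamentalUnits T N len pt tpt →
      (∀ i, @IsIsolatedInHSMaxLocus ((T i).X 0) ((T i).ln 0) N (pt i)) →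
      ∃ i, μ ((T i).X 0) (pt i) < μ ((T 0).X 0) (pt 0))
    (T : ℕ → BlowupTower.{u}) (N : ℕ) (len : ℕ → ℕ) (pt : ∀ i, (T i).X 0) (tpt : ∀ i, (T i).X (len i))
    (hK : KeySetting (T 0) N) (hc : IsLocalizedChainOfFundamentalUnits T N len pt tpt)
    (hiso : ∀ i, @IsIsolatedInHSMaxLocus ((T i).X 0) ((T i).ln 0) N (pt i)) : False := by
  -- from every start `k` there is a later start `k + i` with smaller `μ`
  have hstep : ∀ k, ∃ k', μ ((T k').X 0) (pt k') < μ ((T k).X 0) (pt k) := by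
    intro k
    obtain ⟨i, hi⟩ := hμ (fun i => T (k + i)) N (fun i => len (k + i)) (fun i => pt (k + i)) (fun i => tpt (k + i))
      (keySetting_all hc hK k) (tail hc k) (fun i => hiso (k + i))
    exact ⟨k + i, hi⟩
  choose next hnext using hstep
  -- the orbit of `0` under `next` carries a strictly decreasing sequence of naturals
  let orbit : ℕ → ℕ := fun n => next^[n] 0
  have hdec : ∀ n, μ ((T (orbit (n + 1))).X 0) (pt (orbit (n + 1))) < μ ((T (orbit n)).X 0) (pt (orbit n)) := by
    intro n
    show μ ((T (next^[n + 1] 0)).X 0) (pt (next^[n + 1] 0)) < μ ((T (next^[n] 0)).X 0) (pt (next^[n] 0))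
    rw [Function.iterate_succ_apply']
    exact hnext _
  exact not_strictAnti_of_wellFoundedLT (fun n => μ ((T (orbit n)).X 0) (pt (orbit n))) (strictAnti_nat_of_succ_lt hdec)

/-- **Reduction 1, named form**: an `ℕ`-valued function of pointed schemes that strictly drops somewhere along every
unit-wise localised chain in the key setting with isolated starts proves `Moving.KeyTheorem640_localized_isolated`.
[cite: CossartJannsenSaito2020, Thm. 13.7 (proof)] -/
theorem keyTheorem640_localized_isolated_of_exists_lt (μ : ∀ X : Scheme.{u}, X → ℕ)
    (hμ : ∀ (T : ℕ → BlowupTower.{u}) (N : ℕ) (len : ℕ → ℕ) (pt : ∀ i, (T i).X 0) (tpt : ∀ i, (T i).X (len i)),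
      KeySetting (T 0) N → IsLocalizedChainOfFundamentalUnits T N len pt tpt →
      (∀ i, @IsIsolatedInHSMaxLocus ((T i).X 0) ((T i).ln 0) N (pt i)) →
      ∃ i, μ ((T i).X 0) (pt i) < μ ((T 0).X 0) (pt 0)) :
    Moving.KeyTheorem640_localized_isolated.{u} :=
  fun T N len pt tpt hK hc hiso => false_of_chain_of_exists_lt μ hμ T N len pt tpt hK hc hiso

/-- **Reduction 2 (the printed architecture of Thm. 6.40 = Prop. 13.5 + Thm. 13.7 + Thm. 14.4).** Suppose `β` is an
`ℕ`-valued function of pointed schemes (printed: the numerator of `β^O_x(X, Z) ∈ (1/n_N!)ℤ_{≥0}` over the common denominator,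
(11.4), read on the local initial parts) such that, along every unit-wise localised chain in the key setting with isolated
starts, (i) `β(x^{(q+1)}) ≤ β(x^{(q)})` for every `q` (Prop. 13.5 for `k(x) = k(x_1)`, Thm. 14.4 otherwise), and (ii) `β` is
NOT constant along the whole chain (Thm. 13.7's Claim 13.8: on a constant-`β` chain every unit has trivial residue extension
by Thm. 14.4, and then `ζ^O` strictly decreases — impossible). Then `Moving.KeyTheorem640_localized_isolated`: by (i) `β` is
eventually constant, and the tail from there on is a chain (`tail`, `keySetting_all`) violating (ii).
[cite: CossartJannsenSaito2020, Prop. 13.5, Thm. 13.7, Claim 13.8, Thm. 14.4] -/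
theorem keyTheorem640_localized_isolated_of_antitone_of_not_const (β : ∀ X : Scheme.{u}, X → ℕ)
    (hle : ∀ (T : ℕ → BlowupTower.{u}) (N : ℕ) (len : ℕ → ℕ) (pt : ∀ i, (T i).X 0) (tpt : ∀ i, (T i).X (len i)),
      KeySetting (T 0) N → IsLocalizedChainOfFundamentalUnits T N len pt tpt →
      (∀ i, @IsIsolatedInHSMaxLocus ((T i).X 0) ((T i).ln 0) N (pt i)) →
      ∀ i, β ((T (i + 1)).X 0) (pt (i + 1)) ≤ β ((T i).X 0) (pt i))
    (hnc : ∀ (T : ℕ → BlowupTower.{u}) (N : ℕ) (len : ℕ → ℕ) (pt : ∀ i, (T i).X 0) (tpt : ∀ i, (T i).X (len i)),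
      KeySetting (T 0) N → IsLocalizedChainOfFundamentalUnits T N len pt tpt →
      (∀ i, @IsIsolatedInHSMaxLocus ((T i).X 0) ((T i).ln 0) N (pt i)) →
      ¬ ∀ i, β ((T i).X 0) (pt i) = β ((T 0).X 0) (pt 0)) :
    Moving.KeyTheorem640_localized_isolated.{u} := by
  intro T N len pt tpt hK hc hiso
  -- `β` along the initial points is antitone, hence eventually constant
  let b : ℕ → ℕ := fun i => β ((T i).X 0) (pt i)
  have hanti : Antitone b := antitone_nat_of_succ_le (hle T N len pt tpt hK hc hiso)
  -- a minimal value is attained at some `k`; from `k` on `b` is constant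
  obtain ⟨k, hk⟩ : ∃ k, ∀ i, k ≤ i → b i = b k := by
    classical
    have hne : (Set.range b).Nonempty := ⟨b 0, 0, rfl⟩
    obtain ⟨k, hk⟩ : ∃ k, b k = sInf (Set.range b) := by
      have := Nat.sInf_mem hne
      obtain ⟨k, hk⟩ := this
      exact ⟨k, hk⟩
    refine ⟨k, fun i hi => le_antisymm (hanti hi) ?_⟩
    rw [hk]
    exact Nat.sInf_le ⟨i, rfl⟩
  -- the tail from `k` is a chain in the key setting with isolated starts and constant `β`
  exact hnc (fun i => T (k + i)) N (fun i => len (k + i)) (fun i => pt (k + i)) (fun i => tpt (k + i))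
    (keySetting_all hc hK k) (tail hc k) (fun i => hiso (k + i)) (fun i => hk (k + i) (Nat.le_add_right k i))

end Summit.ResolutionOfSingularities.ResolutionOfSingularities.Theorems.SigmaMaxModificationsCorridor3.KeyClaim

end
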